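import Summits.AtomisticToContinuum.Crystallization.Theorems.ThreeConeCertificateExactCertificateFieldInvisible
import Summits.AtomisticToContinuum.Crystallization.Theorems.ExactCertificate.Negative.NormalForm

/-!
# `ExactCertificate` (stmt-AtomisticToContinuum-11959): lattice periodisation of a positive-type
# radial kernel, III — competitors are `f`-neutral within twice their excess energy

Line `closure-makes-nogap-exact`, necessity side (registered stub `stub_competitorNeutrality`).
Let `(ρ, c, g, U, f)` be a three-cone split of `V_LJ` (`IsSplit ρ c g U f`) attaining a periodic
configuration `P` (`c + f 0/2 ≤ −e(P)`), and let `Q = F + G` be ANY periodic configuration of `ℝ³`.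
Write `S(v) = Σ_d f(dist v (latVec Q d))` for the periodisation of `f` along the periods of `Q`
(every coset family is summable, part 0 `…FieldSummable`).  Then

* `competitor_sum_motif_field_eq` : `Σ_{x, x' ∈ F} S(x − x') = #F · (f 0 + 2 e_f(Q))`
  (site sums are fields minus the self term, part II `…FieldInvisible`);
* `competitor_neutrality_nonneg` : **`0 ≤ f 0 + 2 e_f(Q)`** for every split — the periodisation
  is of positive type (part I `…FieldPeriodic`), tested on the motif with unit weights;
* `competitor_block_sum_eq` : along the `K`-blocks of `Q`,
  `2 E_f(Q_K) + N_K · f 0 = Σ_{x, x' ∈ F} Σ_{k, k' ∈ [0,K)³} f(dist (x − x') (latVec Q (k' − k)))`,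
  and the inner double sums are `K³ · S(x − x') + o(K³)` (`blockAverage`), while the `f`-slack of
  the blocks of a witness is bounded by the excess energy of `Q`
  (`ExactCertificateNegative.f_slack_le_of_periodic`: `E_f(Q_K) + N_K f 0/2 ≤ (e(Q) − e* + ε) N_K`);
  dividing by `N_K = #F · K³` and letting `ε → 0`:
* `competitor_neutrality_le` : **`f 0 + 2 e_f(Q) ≤ 2 (e(Q) − e(P))`** (`e(P) = e*` for a witness).

Together (`stub_competitorNeutrality`): near-optimal periodic competitors are `f`-neutral within
twice their excess energy — the rigorous core of the "Barlow squeeze".  All `[folklore]`.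
-/

noncomputable section

namespace Summit.AtomisticToContinuum.Crystallization.Theorems.ThreeConeCertificateExactCertificate.Field

open Literature.MathematicalPhysics.StatisticalMechanics
open Summit.AtomisticToContinuum.Crystallization.Theorems.ChargedEnergyGapNegative (E3 eStar)
open Summit.AtomisticToContinuum.Crystallization.Theorems.ChargedEnergyGapNegative.Blocks
  (latVec coords BIdx bpt blockConfig card_BIdx siteSum sum_siteSum_eq)
open Summit.AtomisticToContinuum.Crystallization.Theorems.ExactCertificateNegative
  (IsSplit f_slack_le_of_periodic)
open scoped BigOperators

/-! ## The motif double sum of the periodisation -/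

/-- **The motif double sum of the periodisation is `#F · (f 0 + 2 e_f)`**:
`Σ_{x ∈ F} Σ_{x' ∈ F} S(x − x') = Σ_{x ∈ F} (siteSum f x + f 0) = #F · (f 0 + 2 e_f(P))`,
whenever the coset families converge. [folklore] -/
theorem competitor_sum_motif_field_eq (P : PeriodicConfiguration 3) (f : ℝ → ℝ)
    (hs : ∀ v : E3, Summable fun d : Fin 3 → ℤ => f (dist v (latVec P d))) :
    ∑ x ∈ P.motif, ∑ x' ∈ P.motif, ∑' d : Fin 3 → ℤ, f (dist (x - x') (latVec P d)) =
      P.motif.card * (f 0 + 2 * P.energyPerParticle f) := by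
  have h1 : ∀ x ∈ P.motif, ∑ x' ∈ P.motif, ∑' d : Fin 3 → ℤ, f (dist (x - x') (latVec P d)) =
      siteSum P f x + f 0 := fun x hx => by
    rw [siteSum_eq_field_sub P f hs hx, sub_add_cancel]
  rw [Finset.sum_congr rfl h1, Finset.sum_add_distrib, sum_siteSum_eq, Finset.sum_const,
    nsmul_eq_mul]
  ring

/-! ## Lower bound: the periodisation is of positive type -/

/-- A positive-type kernel `S` on `ℝ³` has non-negative double sums over every finite set with unit
weights: `0 ≤ Σ_{x, x' ∈ F} S(x − x')` (enumerate `F`). [folklore] -/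
theorem competitor_sum_sum_nonneg_of_posType (S : E3 → ℝ) (F : Finset E3)
    (hA : ∀ (n : ℕ) (u : Fin n → E3) (W : Fin n → ℝ), 0 ≤ ∑ i, ∑ j, W i * W j * S (u i - u j)) :
    0 ≤ ∑ x ∈ F, ∑ x' ∈ F, S (x - x') := by
  have hsum : ∀ g : E3 → ℝ, ∑ i, g (F.equivFin.symm i) = ∑ x ∈ F, g x := fun g => by
    rw [← Finset.sum_coe_sort F]
    exact F.equivFin.symm.sum_comp (fun x : F => g x)
  have key := hA F.card (fun i => (F.equivFin.symm i : E3)) (fun _ => 1)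
  simp only [one_mul] at key
  rw [← hsum fun x => ∑ x' ∈ F, S (x - x')]
  exact key.trans_eq (Finset.sum_congr rfl fun i _ => hsum fun x' => S (F.equivFin.symm i - x'))

/-- **Bochner lower bound for every periodic configuration: `0 ≤ f 0 + 2 e_f(Q)`** for the `f` of
ANY split (no witness needed) — the lattice periodisation of `f` is of positive type
(`periodisation_posType_of_isSplit`), and its motif double sum is `#F · (f 0 + 2 e_f(Q))`.
[folklore] -/
theorem competitor_neutrality_nonneg (Q : PeriodicConfiguration 3) {ρ c : ℝ} {g U f : ℝ → ℝ}
    (h : IsSplit ρ c g U f) : 0 ≤ f 0 + 2 * Q.energyPerParticle f := by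
  have hF : (0 : ℝ) < Q.motif.card := by exact_mod_cast Q.motif_nonempty.card_pos
  have h1 : 0 ≤ ∑ x ∈ Q.motif, ∑ x' ∈ Q.motif, ∑' d : Fin 3 → ℤ, f (dist (x - x') (latVec Q d)) :=
    competitor_sum_sum_nonneg_of_posType (fun v => ∑' d : Fin 3 → ℤ, f (dist v (latVec Q d)))
      Q.motif (periodisation_posType_of_isSplit Q h)
  rw [competitor_sum_motif_field_eq Q f (summable_coset_of_isSplit Q h)] at h1
  exact nonneg_of_mul_nonneg_right h1 hF

/-! ## Upper bound: block convergence against the `f`-slack of a competitor -/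

/-- **Block double sums of `f`, sliced along the motif.** For the `K`-block `Q_K` of `Q`
(`N_K = #F · K³` points `x + latVec Q k`, `x ∈ F`, `k ∈ [0,K)³`):
`2 E_f(Q_K) + N_K · f 0 = Σ_{u, v ∈ Q_K} f(dist u v)
  = Σ_{x, x' ∈ F} Σ_{k, k'} f(dist (x − x') (latVec Q (k' − k)))`. [folklore] -/
theorem competitor_block_sum_eq (Q : PeriodicConfiguration 3) (f : ℝ → ℝ) (K : ℕ) :
    2 * interactionEnergy f (blockConfig Q K) + Fintype.card (BIdx Q K) * f 0 =
      ∑ x ∈ Q.motif, ∑ x' ∈ Q.motif, ∑ k : Fin 3 → Fin K, ∑ k' : Fin 3 → Fin K,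
        f (dist (x - x') (latVec Q (coords K k' - coords K k))) := by
  have h1 : 2 * interactionEnergy f (blockConfig Q K) + Fintype.card (BIdx Q K) * f 0 =
      ∑ u : BIdx Q K, ∑ v : BIdx Q K, f (dist (bpt Q K u) (bpt Q K v)) := by
    rw [Slackness.two_mul_energy_block Q f K]
    have h : ∀ u : BIdx Q K, ∑ v ∈ Finset.univ.erase u, f (dist (bpt Q K u) (bpt Q K v)) =
        ∑ v : BIdx Q K, f (dist (bpt Q K u) (bpt Q K v)) - f 0 := fun u => by
      rw [Finset.sum_erase_eq_sub (Finset.mem_univ u), dist_self]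
    simp only [h, Finset.sum_sub_distrib, Finset.sum_const, Finset.card_univ, nsmul_eq_mul]
    ring
  have h2 : ∑ u : BIdx Q K, ∑ v : BIdx Q K, f (dist (bpt Q K u) (bpt Q K v)) =
      ∑ x : Q.motif, ∑ x' : Q.motif, ∑ k : Fin 3 → Fin K, ∑ k' : Fin 3 → Fin K,
        f (dist ((x : E3) - x') (latVec Q (coords K k' - coords K k))) := by
    simp only [bpt, Fintype.sum_prod_type, dist_add_latVec_add]
    exact Finset.sum_congr rfl fun x _ => Finset.sum_comm
  rw [h1, h2, ← Finset.sum_coe_sort Q.motif]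
  exact Finset.sum_congr rfl fun x _ => Finset.sum_coe_sort Q.motif (fun x' =>
    ∑ k : Fin 3 → Fin K, ∑ k' : Fin 3 → Fin K,
      f (dist ((x : E3) - x') (latVec Q (coords K k' - coords K k))))

/-- Double sums over a finite set depend Lipschitz-continuously on the kernel:
`|Σ_{x,x'} T − a · Σ_{x,x'} S| ≤ #F · #F · δ` if `|T(x,x') − a · S(x,x')| ≤ δ` on `F × F`.
[folklore] -/
theorem competitor_abs_sum_sum_sub_le {α : Type*} (F : Finset α) (T S : α → α → ℝ) (a δ : ℝ)
    (h : ∀ x ∈ F, ∀ x' ∈ F, |T x x' - a * S x x'| ≤ δ) :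
    |∑ x ∈ F, ∑ x' ∈ F, T x x' - a * ∑ x ∈ F, ∑ x' ∈ F, S x x'| ≤ F.card * (F.card * δ) := by
  have hrepr : ∑ x ∈ F, ∑ x' ∈ F, T x x' - a * ∑ x ∈ F, ∑ x' ∈ F, S x x' =
      ∑ x ∈ F, ∑ x' ∈ F, (T x x' - a * S x x') := by
    simp only [Finset.mul_sum, Finset.sum_sub_distrib]
  rw [hrepr]
  calc |∑ x ∈ F, ∑ x' ∈ F, (T x x' - a * S x x')|
      ≤ ∑ x ∈ F, |∑ x' ∈ F, (T x x' - a * S x x')| := Finset.abs_sum_le_sum_abs _ _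
    _ ≤ ∑ x ∈ F, ∑ x' ∈ F, |T x x' - a * S x x'| :=
        Finset.sum_le_sum fun x _ => Finset.abs_sum_le_sum_abs _ _
    _ ≤ ∑ x ∈ F, ∑ x' ∈ F, δ :=
        Finset.sum_le_sum fun x hx => Finset.sum_le_sum fun x' hx' => h x hx x' hx'
    _ = F.card * (F.card * δ) := by simp only [Finset.sum_const, nsmul_eq_mul]

/-- **The `f`-neutrality defect of a competitor is at most twice its excess energy over `e*`**:
for a witness `(P, ρ, c, g, U, f)` and every periodic `Q`, `f 0 + 2 e_f(Q) ≤ 2 (e(Q) − e*)`.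
Proof: for `ε > 0` and `K` large, `K³ · #F · (f 0 + 2e_f(Q)) − #F K³ ε/2 ≤ 2E_f(Q_K) + N_K f 0`
(block identity and block averages over the `#F²` pairs of motif points) and
`2E_f(Q_K) + N_K f 0 ≤ 2 (e(Q) − e* + ε/4) N_K` (the `f`-slack of the blocks of `Q`); divide by
`N_K = #F K³` and let `ε → 0`. [folklore] -/
theorem competitor_neutrality_le_eStar {P : PeriodicConfiguration 3} {ρ c : ℝ} {g U f : ℝ → ℝ}
    (h : IsSplit ρ c g U f) (hv : c + f 0 / 2 ≤ -(P.energyPerParticle lennardJones))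
    (Q : PeriodicConfiguration 3) :
    f 0 + 2 * Q.energyPerParticle f ≤ 2 * (Q.energyPerParticle lennardJones - eStar) := by
  have hs := summable_coset_of_isSplit Q h
  have hA := competitor_sum_motif_field_eq Q f hs
  have hne : Q.motif.Nonempty := Q.motif_nonempty
  have hF : (0 : ℝ) < Q.motif.card := by exact_mod_cast hne.card_pos
  have hF0 : (Q.motif.card : ℝ) ≠ 0 := hF.ne'
  refine le_of_forall_pos_le_add fun ε hε => ?_
  have hε₄ : (0 : ℝ) < ε / 4 := by positivity
  have hε' : (0 : ℝ) < ε / (2 * (Q.motif.card : ℝ)) := by positivity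
  obtain ⟨K₁, hK₁, hslack⟩ := f_slack_le_of_periodic h hv Q hε₄
  choose K₀ hK₀ using fun v : E3 => blockAverage Q f v (hs v) hε'
  -- a block size beyond `K₁` and beyond the `K₀` of every pair of motif points
  obtain ⟨K, hKK₁, hKK₀⟩ : ∃ K : ℕ, K₁ ≤ K ∧ ∀ x ∈ Q.motif, ∀ x' ∈ Q.motif, K₀ (x - x') ≤ K := by
    refine ⟨max K₁ ((Q.motif ×ˢ Q.motif).sup fun p => K₀ (p.1 - p.2)), le_max_left _ _,
      fun x hx x' hx' => le_trans ?_ (le_max_right _ _)⟩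
    exact Finset.le_sup (f := fun p : E3 × E3 => K₀ (p.1 - p.2)) (Finset.mk_mem_product hx hx')
  have hKpos : (0 : ℝ) < K := by exact_mod_cast hK₁.trans_le hKK₁
  have hK3 : (0 : ℝ) < (K : ℝ) ^ 3 := by positivity
  have hcard : ((Fintype.card (BIdx Q K) : ℕ) : ℝ) = (Q.motif.card : ℝ) * (K : ℝ) ^ 3 := by
    rw [card_BIdx]; push_cast; ring
  -- (1) the `f`-slack of the `K`-block of `Q`
  have h1 := hslack K hKK₁
  rw [hcard] at h1
  -- (2) the block identity
  have h2 := competitor_block_sum_eq Q f K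
  rw [hcard] at h2
  -- (3) block averages, summed over the pairs of motif points
  have h3 : |∑ x ∈ Q.motif, ∑ x' ∈ Q.motif, ∑ k : Fin 3 → Fin K, ∑ k' : Fin 3 → Fin K,
        f (dist (x - x') (latVec Q (coords K k' - coords K k))) -
      (K : ℝ) ^ 3 * ∑ x ∈ Q.motif, ∑ x' ∈ Q.motif, ∑' d : Fin 3 → ℤ, f (dist (x - x') (latVec Q d))|
      ≤ (Q.motif.card : ℝ) * ((Q.motif.card : ℝ) * (ε / (2 * (Q.motif.card : ℝ)) * (K : ℝ) ^ 3)) :=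
    competitor_abs_sum_sum_sub_le Q.motif
      (fun x x' => ∑ k : Fin 3 → Fin K, ∑ k' : Fin 3 → Fin K,
        f (dist (x - x') (latVec Q (coords K k' - coords K k))))
      (fun x x' => ∑' d : Fin 3 → ℤ, f (dist (x - x') (latVec Q d))) _ _
      (fun x hx x' hx' => hK₀ (x - x') K (hKK₀ x hx x' hx'))
  rw [hA] at h3
  have h3' := (abs_le.1 h3).1
  -- (4) arithmetic: divide by `N_K = #F · K³ > 0`
  have e1 : (Q.motif.card : ℝ) * ((Q.motif.card : ℝ) * (ε / (2 * (Q.motif.card : ℝ)) * (K : ℝ) ^ 3))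
      = (K : ℝ) ^ 3 * (Q.motif.card : ℝ) * (ε / 2) := by
    field_simp
  rw [e1] at h3'
  have h4 : (K : ℝ) ^ 3 * (Q.motif.card : ℝ) * (f 0 + 2 * Q.energyPerParticle f) ≤
      (K : ℝ) ^ 3 * (Q.motif.card : ℝ) * (2 * (Q.energyPerParticle lennardJones - eStar) + ε) := by
    linarith [h1, h2, h3']
  exact le_of_mul_le_mul_left h4 (mul_pos hK3 hF)

/-- **… and `e* = e(P)` for a witness**: `f 0 + 2 e_f(Q) ≤ 2 (e(Q) − e(P))` for every periodic `Q`.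
[folklore] -/
theorem competitor_neutrality_le {P : PeriodicConfiguration 3} {ρ c : ℝ} {g U f : ℝ → ℝ}
    (h : IsSplit ρ c g U f) (hv : c + f 0 / 2 ≤ -(P.energyPerParticle lennardJones))
    (Q : PeriodicConfiguration 3) :
    f 0 + 2 * Q.energyPerParticle f ≤
      2 * (Q.energyPerParticle lennardJones - P.energyPerParticle lennardJones) := by
  rw [(Slackness.witness_eq h hv).1]
  exact competitor_neutrality_le_eStar h hv Q

/-! ## The registered stub -/

/-- **Registered stub `stub_competitorNeutrality` of crux item stmt-AtomisticToContinuum-11959**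
(line `closure-makes-nogap-exact`, necessity side; signature verbatim): for a witness
`(P, ρ, c, g, U, f)` of `ExactCertificate` and EVERY periodic configuration `Q` of `ℝ³`,
`0 ≤ f 0 + 2 e_f(Q) ≤ 2 (e(Q) − e(P))` — near-optimal periodic competitors are `f`-neutral within
twice their excess energy. [folklore] -/
theorem stub_competitorNeutrality : ∀ (P Q : PeriodicConfiguration 3) (ρ c : ℝ) (g U f : ℝ → ℝ),
    Summit.AtomisticToContinuum.Crystallization.Theorems.ExactCertificateNegative.IsSplit ρ c g U f →
    c + f 0 / 2 ≤ -(P.energyPerParticle lennardJones) →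
    0 ≤ f 0 + 2 * Q.energyPerParticle f ∧
      f 0 + 2 * Q.energyPerParticle f ≤
        2 * (Q.energyPerParticle lennardJones - P.energyPerParticle lennardJones) :=
  fun _ Q _ _ _ _ _ h hv => ⟨competitor_neutrality_nonneg Q h, competitor_neutrality_le h hv Q⟩

end Summit.AtomisticToContinuum.Crystallization.Theorems.ThreeConeCertificateExactCertificate.Field

end
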